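import Mathlib
import Summits.KontsevichZagierPeriods.Zeta5Search.SorokinCensus.GeneralizedEuler
import HarnessLib

/-!
HONEST FRAMING: systematic search; no irrationality claim unless certified.

# The generalized Sorokin family `J₅^gen` — ReversalCoords (FAMILY.md §17; = Fischler's `𝒥(p)`, C. R. Math. 335 (2002) §3)

This module: the continued-product coordinates `Xmap : x ↦ (tailQ x i)_i` onto the zigzag `cell`, inverse `Xinv`, the volume-preserving coordinate reversal `urev`, and the Jacobian `XDeriv` (upper triangular, `|det| = u₂u₃u₄u₅`).

fam-sorokin gen 4 (planner-pub-zeta5-fam-sorokin-g4-0), staged `SorokinGeneralized.lean` v9 (sha256 e6bbed22…, 1570 l., filing request #2 FINAL-6 = last); split by the cell filing lane (lead/lit g11) at the gate's 400-line cap into `Generalized` (defs + statement nodes) → `GeneralizedSigma` → `GeneralizedMoves` → `GeneralizedEuler` → `GeneralizedReversalCoords` → `GeneralizedReversal` (linear import chain; mathematics verbatim, one-line docstrings added where missing, a private cube-measurability lemma duplicated across the split).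
Nothing here is an irrationality statement: elementary identities / calculus of absolutely convergent 5-fold integrals and integer bookkeeping.
-/

namespace Summit.KontsevichZagierPeriods.Zeta5Search.SorokinCensus

open Literature.NumberTheory.Irrationality.Zudilin2002 MeasureTheory Finset Set
open GenPoint

/-! ## The reversal identity `ReversalInvariance` via the continued-product coordinates `u = (u₁,…,u₅)`

`Xmap x = (tailQ x 0, …, tailQ x 4)` is a polynomial map with upper-triangular Jacobian (`|det| = u₂u₃u₄u₅`), injective on
the open cube with image the zigzag `cell`; in these coordinates the integrand times `|det D(Xmap⁻¹)|` is the Laurent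
monomial `GenPoint.hU`, and path reversal is the coordinate reversal `urev` of the cell (volume-preserving), under which
`hU (rev p) = hU p ∘ urev` identically in the integer exponents. -/

/-- `tailQ_four_eq`: `(x : Fin 5 → ℝ) : tailQ x 4 = 1 - x 4`. -/
theorem tailQ_four_eq (x : Fin 5 → ℝ) : tailQ x 4 = 1 - x 4 := by
  simp [tailQ, List.ofFn_succ, nestedQ, List.drop_succ_cons]

/-- `tailQ_five_eq`: `(x : Fin 5 → ℝ) : tailQ x 5 = 1`. -/
theorem tailQ_five_eq (x : Fin 5 → ℝ) : tailQ x 5 = 1 := by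
  simp [tailQ, List.ofFn_succ, nestedQ, List.drop_succ_cons]

/-- `tailQ_step1`: `(x : Fin 5 → ℝ) : tailQ x 1 = 1 - x 1 * tailQ x 2`. -/
theorem tailQ_step1 (x : Fin 5 → ℝ) : tailQ x 1 = 1 - x 1 * tailQ x 2 := by
  rw [tailQ_one_eq, tailQ_two_eq]
/-- `tailQ_step2`: `(x : Fin 5 → ℝ) : tailQ x 2 = 1 - x 2 * tailQ x 3`. -/
theorem tailQ_step2 (x : Fin 5 → ℝ) : tailQ x 2 = 1 - x 2 * tailQ x 3 := by
  rw [tailQ_two_eq, tailQ_three_eq]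
/-- `tailQ_step3`: `(x : Fin 5 → ℝ) : tailQ x 3 = 1 - x 3 * tailQ x 4`. -/
theorem tailQ_step3 (x : Fin 5 → ℝ) : tailQ x 3 = 1 - x 3 * tailQ x 4 := by
  rw [tailQ_three_eq, tailQ_four_eq]

/-- The u-coordinates. -/
def Xmap (x : Fin 5 → ℝ) : Fin 5 → ℝ := ![tailQ x 0, tailQ x 1, tailQ x 2, tailQ x 3, tailQ x 4]

/-- `Xmap_apply_zero`: `(x : Fin 5 → ℝ) : Xmap x 0 = tailQ x 0`. -/
@[simp] theorem Xmap_apply_zero (x : Fin 5 → ℝ) : Xmap x 0 = tailQ x 0 := rfl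
/-- `Xmap_apply_one` (simp lemma). -/
@[simp] theorem Xmap_apply_one (x : Fin 5 → ℝ) : Xmap x 1 = tailQ x 1 := rfl
/-- `Xmap_apply_two` (simp lemma). -/
@[simp] theorem Xmap_apply_two (x : Fin 5 → ℝ) : Xmap x 2 = tailQ x 2 := rfl
/-- `Xmap_apply_three` (simp lemma). -/
@[simp] theorem Xmap_apply_three (x : Fin 5 → ℝ) : Xmap x 3 = tailQ x 3 := rfl
/-- `Xmap_apply_four` (simp lemma). -/
@[simp] theorem Xmap_apply_four (x : Fin 5 → ℝ) : Xmap x 4 = tailQ x 4 := rfl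

/-- `Xmap_apply`: `(x : Fin 5 → ℝ) (i : Fin 5) : Xmap x i = tailQ x i`. -/
theorem Xmap_apply (x : Fin 5 → ℝ) (i : Fin 5) : Xmap x i = tailQ x i := by
  fin_cases i <;> rfl

/-- The inverse coordinates `x_i = (1-u_i)/u_{i+1}` (`u_5 = 1`). -/
noncomputable def Xinv (u : Fin 5 → ℝ) : Fin 5 → ℝ :=
  ![(1 - u 0) / u 1, (1 - u 1) / u 2, (1 - u 2) / u 3, (1 - u 3) / u 4, 1 - u 4]

/-- `Xinv_apply_zero`: `(u : Fin 5 → ℝ) : Xinv u 0 = (1 - u 0) / u 1`. -/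
@[simp] theorem Xinv_apply_zero (u : Fin 5 → ℝ) : Xinv u 0 = (1 - u 0) / u 1 := rfl
/-- `Xinv_apply_one` (simp lemma). -/
@[simp] theorem Xinv_apply_one (u : Fin 5 → ℝ) : Xinv u 1 = (1 - u 1) / u 2 := rfl
/-- `Xinv_apply_two` (simp lemma). -/
@[simp] theorem Xinv_apply_two (u : Fin 5 → ℝ) : Xinv u 2 = (1 - u 2) / u 3 := rfl
/-- `Xinv_apply_three` (simp lemma). -/
@[simp] theorem Xinv_apply_three (u : Fin 5 → ℝ) : Xinv u 3 = (1 - u 3) / u 4 := rfl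
/-- `Xinv_apply_four` (simp lemma). -/
@[simp] theorem Xinv_apply_four (u : Fin 5 → ℝ) : Xinv u 4 = 1 - u 4 := rfl

/-- The zigzag cell (`t₁ > t₂ < t₃ > t₄ < t₅` in path coordinates). -/
def cell : Set (Fin 5 → ℝ) :=
  {u | 0 < u 4} ∩ {u | u 4 < 1} ∩ {u | 1 - u 1 < u 0} ∩ {u | u 0 < 1} ∩ {u | 1 - u 2 < u 1} ∩ {u | u 1 < 1} ∩
    {u | 1 - u 3 < u 2} ∩ {u | u 2 < 1} ∩ {u | 1 - u 4 < u 3} ∩ {u | u 3 < 1}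

/-- `mem_cell`: `{u : Fin 5 → ℝ} : u ∈ cell ↔ 0 < u 4 ∧ u 4 < 1 ∧ 1 - u 1 < u 0 ∧ u 0 < 1 ∧ 1 - u 2 < u 1 ∧ u 1 < 1 ∧ 1 - u …`. -/
theorem mem_cell {u : Fin 5 → ℝ} : u ∈ cell ↔
    0 < u 4 ∧ u 4 < 1 ∧ 1 - u 1 < u 0 ∧ u 0 < 1 ∧ 1 - u 2 < u 1 ∧ u 1 < 1 ∧
      1 - u 3 < u 2 ∧ u 2 < 1 ∧ 1 - u 4 < u 3 ∧ u 3 < 1 := by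
  simp only [cell, Set.mem_inter_iff, Set.mem_setOf_eq, and_assoc]

/-- `measurableSet_cell`: `: MeasurableSet cell`. -/
theorem measurableSet_cell : MeasurableSet cell := by
  unfold cell
  apply_rules [MeasurableSet.inter, measurableSet_lt, measurable_const, measurable_pi_apply, Measurable.const_sub]

/-- On the open cube all continued products `tailQ x i`, `i ≤ 4`, are in `(0,1)`. -/
theorem tailQ_bounds' {x : Fin 5 → ℝ} (hx : x ∈ ocube) :
    (0 < tailQ x 0 ∧ tailQ x 0 < 1) ∧ (0 < tailQ x 1 ∧ tailQ x 1 < 1) ∧ (0 < tailQ x 2 ∧ tailQ x 2 < 1) ∧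
      (0 < tailQ x 3 ∧ tailQ x 3 < 1) ∧ (0 < tailQ x 4 ∧ tailQ x 4 < 1) := by
  obtain ⟨h1, h2, h3⟩ := tailQ_bounds hx
  have hx' := mem_ocube.mp hx
  refine ⟨?_, h1, h2, h3, ?_⟩
  · rw [tailQ_zero_eq']; exact unit_step (hx' 0) h1
  · rw [tailQ_four_eq]; constructor <;> linarith [(hx' 4).1, (hx' 4).2]

/-- `Xinv_Xmap`: `{x : Fin 5 → ℝ} (hx : x ∈ ocube) : Xinv (Xmap x) = x`. -/
theorem Xinv_Xmap {x : Fin 5 → ℝ} (hx : x ∈ ocube) : Xinv (Xmap x) = x := by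
  obtain ⟨_, h1, h2, h3, h4⟩ := tailQ_bounds' hx
  have n1 := h1.1.ne'; have n2 := h2.1.ne'; have n3 := h3.1.ne'; have n4 := h4.1.ne'
  funext j
  fin_cases j
  · show (1 - tailQ x 0) / tailQ x 1 = x 0
    rw [tailQ_zero_eq' x]; field_simp; ring
  · show (1 - tailQ x 1) / tailQ x 2 = x 1
    rw [tailQ_step1 x]; field_simp; ring
  · show (1 - tailQ x 2) / tailQ x 3 = x 2
    rw [tailQ_step2 x]; field_simp; ring
  · show (1 - tailQ x 3) / tailQ x 4 = x 3
    rw [tailQ_step3 x]; field_simp; ring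
  · show 1 - tailQ x 4 = x 4
    rw [tailQ_four_eq]; ring

/-- `Xmap_injOn`: `: Set.InjOn Xmap ocube`. -/
theorem Xmap_injOn : Set.InjOn Xmap ocube := by
  intro x hx y hy h
  rw [← Xinv_Xmap hx, ← Xinv_Xmap hy, h]

/-- `Xmap_mem_cell`: `{x : Fin 5 → ℝ} (hx : x ∈ ocube) : Xmap x ∈ cell`. -/
theorem Xmap_mem_cell {x : Fin 5 → ℝ} (hx : x ∈ ocube) : Xmap x ∈ cell := by
  obtain ⟨h0, h1, h2, h3, h4⟩ := tailQ_bounds' hx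
  have hx' := mem_ocube.mp hx
  rw [mem_cell]
  simp only [Xmap_apply_zero, Xmap_apply_one, Xmap_apply_two, Xmap_apply_three, Xmap_apply_four]
  refine ⟨h4.1, h4.2, ?_, h0.2, ?_, h1.2, ?_, h2.2, ?_, h3.2⟩
  · rw [tailQ_zero_eq' x]; nlinarith [(hx' 0).2, h1.1]
  · rw [tailQ_step1 x]; nlinarith [(hx' 1).2, h2.1]
  · rw [tailQ_step2 x]; nlinarith [(hx' 2).2, h3.1]
  · rw [tailQ_step3 x]; nlinarith [(hx' 3).2, h4.1]

/-- `Xmap_Xinv`: `{u : Fin 5 → ℝ} (hu : u ∈ cell) : Xmap (Xinv u) = u`. -/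
theorem Xmap_Xinv {u : Fin 5 → ℝ} (hu : u ∈ cell) : Xmap (Xinv u) = u := by
  obtain ⟨h4, h4', h0, h0', h1, h1', h2, h2', h3, h3'⟩ := mem_cell.mp hu
  have n1 : u 1 ≠ 0 := by apply ne_of_gt; linarith
  have n2 : u 2 ≠ 0 := by apply ne_of_gt; linarith
  have n3 : u 3 ≠ 0 := by apply ne_of_gt; linarith
  have n4 : u 4 ≠ 0 := h4.ne'
  have e4 : tailQ (Xinv u) 4 = u 4 := by rw [tailQ_four_eq, Xinv_apply_four]; ring
  have e3 : tailQ (Xinv u) 3 = u 3 := by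
    rw [tailQ_step3, e4, Xinv_apply_three]; field_simp; ring
  have e2 : tailQ (Xinv u) 2 = u 2 := by
    rw [tailQ_step2, e3, Xinv_apply_two]; field_simp; ring
  have e1 : tailQ (Xinv u) 1 = u 1 := by
    rw [tailQ_step1, e2, Xinv_apply_one]; field_simp; ring
  have e0 : tailQ (Xinv u) 0 = u 0 := by
    rw [tailQ_zero_eq', e1, Xinv_apply_zero]; field_simp; ring
  funext j
  fin_cases j
  · exact e0
  · exact e1
  · exact e2
  · exact e3
  · exact e4

/-- `Xinv_mem_ocube`: `{u : Fin 5 → ℝ} (hu : u ∈ cell) : Xinv u ∈ ocube`. -/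
theorem Xinv_mem_ocube {u : Fin 5 → ℝ} (hu : u ∈ cell) : Xinv u ∈ ocube := by
  obtain ⟨h4, h4', h0, h0', h1, h1', h2, h2', h3, h3'⟩ := mem_cell.mp hu
  have p1 : 0 < u 1 := by linarith
  have p2 : 0 < u 2 := by linarith
  have p3 : 0 < u 3 := by linarith
  rw [mem_ocube]
  intro j
  fin_cases j
  · show 0 < (1 - u 0) / u 1 ∧ (1 - u 0) / u 1 < 1
    exact ⟨div_pos (by linarith) p1, (div_lt_one p1).mpr (by linarith)⟩
  · show 0 < (1 - u 1) / u 2 ∧ (1 - u 1) / u 2 < 1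
    exact ⟨div_pos (by linarith) p2, (div_lt_one p2).mpr (by linarith)⟩
  · show 0 < (1 - u 2) / u 3 ∧ (1 - u 2) / u 3 < 1
    exact ⟨div_pos (by linarith) p3, (div_lt_one p3).mpr (by linarith)⟩
  · show 0 < (1 - u 3) / u 4 ∧ (1 - u 3) / u 4 < 1
    exact ⟨div_pos (by linarith) h4, (div_lt_one h4).mpr (by linarith)⟩
  · show 0 < 1 - u 4 ∧ 1 - u 4 < 1
    constructor <;> linarith

/-- `Xmap_image`: `: Xmap '' ocube = cell`. -/
theorem Xmap_image : Xmap '' ocube = cell := by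
  refine Set.Subset.antisymm ?_ ?_
  · rintro _ ⟨x, hx, rfl⟩; exact Xmap_mem_cell hx
  · intro u hu; exact ⟨Xinv u, Xinv_mem_ocube hu, Xmap_Xinv hu⟩

/-- Coordinate reversal `u ↦ (u₄,u₃,u₂,u₁,u₀)` (= path reversal `t_j ↦ t_{6-j}` in the u-picture). -/
def urev (u : Fin 5 → ℝ) : Fin 5 → ℝ := fun i => u (Fin.rev i)

/-- `urev_apply_zero`: `(u : Fin 5 → ℝ) : urev u 0 = u 4`. -/
@[simp] theorem urev_apply_zero (u : Fin 5 → ℝ) : urev u 0 = u 4 := rfl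
/-- `urev_apply_one` (simp lemma). -/
@[simp] theorem urev_apply_one (u : Fin 5 → ℝ) : urev u 1 = u 3 := rfl
/-- `urev_apply_two` (simp lemma). -/
@[simp] theorem urev_apply_two (u : Fin 5 → ℝ) : urev u 2 = u 2 := rfl
/-- `urev_apply_three` (simp lemma). -/
@[simp] theorem urev_apply_three (u : Fin 5 → ℝ) : urev u 3 = u 1 := rfl
/-- `urev_apply_four` (simp lemma). -/
@[simp] theorem urev_apply_four (u : Fin 5 → ℝ) : urev u 4 = u 0 := rfl

/-- `urev_urev`: `(u : Fin 5 → ℝ) : urev (urev u) = u`. -/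
theorem urev_urev (u : Fin 5 → ℝ) : urev (urev u) = u := by
  funext i; simp [urev, Fin.rev_rev]

/-- `measurable_urev`: `: Measurable urev`. -/
theorem measurable_urev : Measurable urev :=
  measurable_pi_lambda _ fun _ => measurable_pi_apply _

/-- `urev` as a measurable equivalence. -/
def urevEquiv : (Fin 5 → ℝ) ≃ᵐ (Fin 5 → ℝ) where
  toFun := urev
  invFun := urev
  left_inv := urev_urev
  right_inv := urev_urev
  measurable_toFun := measurable_urev
  measurable_invFun := measurable_urev

/-- `measurePreserving_urev`: `: MeasurePreserving urev volume volume`. -/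
theorem measurePreserving_urev : MeasurePreserving urev volume volume := by
  have h := volume_measurePreserving_piCongrLeft (fun _ : Fin 5 => ℝ) Fin.revPerm
  have hfun : ⇑(MeasurableEquiv.piCongrLeft (fun _ : Fin 5 => ℝ) Fin.revPerm) = urev := by
    funext u j
    simp only [MeasurableEquiv.coe_piCongrLeft, Equiv.piCongrLeft_apply, eq_rec_constant, Fin.revPerm_symm,
      Fin.revPerm_apply, urev]
  rw [hfun] at h
  exact h

/-- `urev_preimage_cell`: `: urev ⁻¹' cell = cell`. -/
theorem urev_preimage_cell : urev ⁻¹' cell = cell := by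
  ext u
  simp only [Set.mem_preimage, mem_cell, urev_apply_zero, urev_apply_one, urev_apply_two, urev_apply_three,
    urev_apply_four]
  constructor
  · rintro ⟨h1, h2, h3, h4, h5, h6, h7, h8, h9, h10⟩
    refine ⟨?_, ?_, ?_, ?_, ?_, ?_, ?_, ?_, ?_, ?_⟩ <;> linarith
  · rintro ⟨h1, h2, h3, h4, h5, h6, h7, h8, h9, h10⟩
    refine ⟨?_, ?_, ?_, ?_, ?_, ?_, ?_, ?_, ?_, ?_⟩ <;> linarith


/-! ### The Jacobian of `Xmap` (upper triangular, `det = -u₂u₃u₄u₅`) -/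

/-- `differentiableAt_Xmap_apply`: `(x : Fin 5 → ℝ) (i : Fin 5) : DifferentiableAt ℝ (fun y => Xmap y i) x`. -/
theorem differentiableAt_Xmap_apply (x : Fin 5 → ℝ) (i : Fin 5) : DifferentiableAt ℝ (fun y => Xmap y i) x := by
  fin_cases i
  · show DifferentiableAt ℝ (fun y => Xmap y 0) x
    simp only [Xmap_apply_zero, tailQ_zero_eq]; fun_prop
  · show DifferentiableAt ℝ (fun y => Xmap y 1) x
    simp only [Xmap_apply_one, tailQ_one_eq]; fun_prop
  · show DifferentiableAt ℝ (fun y => Xmap y 2) x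
    simp only [Xmap_apply_two, tailQ_two_eq]; fun_prop
  · show DifferentiableAt ℝ (fun y => Xmap y 3) x
    simp only [Xmap_apply_three, tailQ_three_eq]; fun_prop
  · show DifferentiableAt ℝ (fun y => Xmap y 4) x
    simp only [Xmap_apply_four, tailQ_four_eq]; fun_prop

/-- The derivative of `Xmap` at `x`. -/
noncomputable def XDeriv (x : Fin 5 → ℝ) : (Fin 5 → ℝ) →L[ℝ] (Fin 5 → ℝ) :=
  ContinuousLinearMap.pi fun i : Fin 5 => fderiv ℝ (fun y => Xmap y i) x

/-- `hasFDerivAt_Xmap`: `(x : Fin 5 → ℝ) : HasFDerivAt Xmap (XDeriv x) x`. -/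
theorem hasFDerivAt_Xmap (x : Fin 5 → ℝ) : HasFDerivAt Xmap (XDeriv x) x := by
  show HasFDerivAt (fun y i => (fun (i : Fin 5) (y : Fin 5 → ℝ) => Xmap y i) i y)
    (ContinuousLinearMap.pi fun i : Fin 5 => fderiv ℝ (fun y => Xmap y i) x) x
  exact hasFDerivAt_pi.2 fun i => (differentiableAt_Xmap_apply x i).hasFDerivAt

/-- `tailQ x i` does not depend on the coordinates `j < i`. -/
theorem Xmap_update_of_lt (x : Fin 5 → ℝ) (t : ℝ) {i j : Fin 5} (h : j < i) :
    Xmap (Function.update x j t) i = Xmap x i := by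
  fin_cases i <;> fin_cases j <;>
    simp (decide := true) [Xmap, tailQ_zero_eq, tailQ_one_eq, tailQ_two_eq, tailQ_three_eq, tailQ_four_eq] at h ⊢

/-- `Xmap_update_self`: `(x : Fin 5 → ℝ) (t : ℝ) (i : Fin 5) : Xmap (Function.update x i t) i = 1 - t * tailQ x (i + 1)`. -/
theorem Xmap_update_self (x : Fin 5 → ℝ) (t : ℝ) (i : Fin 5) :
    Xmap (Function.update x i t) i = 1 - t * tailQ x (i + 1) := by
  fin_cases i <;>
    simp (decide := true) [Xmap, tailQ_zero_eq, tailQ_one_eq, tailQ_two_eq, tailQ_three_eq, tailQ_four_eq,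
      tailQ_five_eq]

/-- `XDeriv_entry_of_lt`: `(x : Fin 5 → ℝ) {i j : Fin 5} (h : j < i) : fderiv ℝ (fun y => Xmap y i) x (Pi.single j 1) = 0`. -/
theorem XDeriv_entry_of_lt (x : Fin 5 → ℝ) {i j : Fin 5} (h : j < i) :
    fderiv ℝ (fun y => Xmap y i) x (Pi.single j 1) = 0 := by
  have hl : HasFDerivAt (fun y => Xmap y i) (fderiv ℝ (fun y => Xmap y i) x) (Function.update x j (x j)) := by
    rw [Function.update_eq_self]; exact (differentiableAt_Xmap_apply x i).hasFDerivAt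
  have hcomp := hl.comp_hasDerivAt (x j) (hasDerivAt_update x j (x j))
  have hfun : (fun y => Xmap y i) ∘ Function.update x j = fun _ => Xmap x i := by
    funext t; simp only [Function.comp_apply]; exact Xmap_update_of_lt x t h
  rw [hfun] at hcomp
  exact hcomp.unique (hasDerivAt_const (x j) (Xmap x i))

/-- `XDeriv_entry_diag`: `(x : Fin 5 → ℝ) (i : Fin 5) : fderiv ℝ (fun y => Xmap y i) x (Pi.single i 1) = -tailQ x (i + 1)`. -/
theorem XDeriv_entry_diag (x : Fin 5 → ℝ) (i : Fin 5) :
    fderiv ℝ (fun y => Xmap y i) x (Pi.single i 1) = -tailQ x (i + 1) := by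
  have hl : HasFDerivAt (fun y => Xmap y i) (fderiv ℝ (fun y => Xmap y i) x) (Function.update x i (x i)) := by
    rw [Function.update_eq_self]; exact (differentiableAt_Xmap_apply x i).hasFDerivAt
  have hcomp := hl.comp_hasDerivAt (x i) (hasDerivAt_update x i (x i))
  have hfun : (fun y => Xmap y i) ∘ Function.update x i = fun t => 1 - t * tailQ x (i + 1) := by
    funext t; simp only [Function.comp_apply]; exact Xmap_update_self x t i
  rw [hfun] at hcomp
  have hexp : HasDerivAt (fun t => 1 - t * tailQ x (i + 1)) (-tailQ x (i + 1)) (x i) := by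
    simpa using ((hasDerivAt_id (x i)).mul_const (tailQ x (i + 1))).const_sub 1
  exact hcomp.unique hexp

/-- `det_XDeriv`: `(x : Fin 5 → ℝ) : (XDeriv x).det = -(tailQ x 1 * tailQ x 2 * tailQ x 3 * tailQ x 4)`. -/
theorem det_XDeriv (x : Fin 5 → ℝ) : (XDeriv x).det = -(tailQ x 1 * tailQ x 2 * tailQ x 3 * tailQ x 4) := by
  show LinearMap.det ((XDeriv x : (Fin 5 → ℝ) →L[ℝ] (Fin 5 → ℝ)) : (Fin 5 → ℝ) →ₗ[ℝ] (Fin 5 → ℝ)) = _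
  rw [← LinearMap.det_toMatrix']
  have hM : ∀ i j, LinearMap.toMatrix' ((XDeriv x : _ →L[ℝ] _) : (Fin 5 → ℝ) →ₗ[ℝ] (Fin 5 → ℝ)) i j =
      fderiv ℝ (fun y => Xmap y i) x (Pi.single j 1) := by
    intro i j
    rw [LinearMap.toMatrix'_apply, ContinuousLinearMap.coe_coe]
    simp [XDeriv]
  rw [Matrix.det_of_upperTriangular]
  · simp only [hM, XDeriv_entry_diag, Fin.prod_univ_five]
    show -tailQ x 1 * -tailQ x 2 * -tailQ x 3 * -tailQ x 4 * -tailQ x 5 = _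
    rw [tailQ_five_eq]; ring
  · intro i j hij
    rw [hM]; exact XDeriv_entry_of_lt x hij

/-- `abs_det_XDeriv`: `{x : Fin 5 → ℝ} (hx : x ∈ ocube) : |(XDeriv x).det| = tailQ x 1 * tailQ x 2 * tailQ x 3 * tailQ x 4`. -/
theorem abs_det_XDeriv {x : Fin 5 → ℝ} (hx : x ∈ ocube) :
    |(XDeriv x).det| = tailQ x 1 * tailQ x 2 * tailQ x 3 * tailQ x 4 := by
  obtain ⟨_, h1, h2, h3, h4⟩ := tailQ_bounds' hx
  rw [det_XDeriv, abs_neg, abs_of_pos (mul_pos (mul_pos (mul_pos h1.1 h2.1) h3.1) h4.1)]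

end Summit.KontsevichZagierPeriods.Zeta5Search.SorokinCensus
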